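import Literature.Probability.LatticeModels.TriMeshTriCells
import Literature.Probability.LatticeModels.MeshGoodColumn
import HarnessLib

/-!
# A column of the sheared triangular mesh without long shallow perfect runs (area count)

Topic: Probability / LatticeModels (triangular twin `TriMesh*` of the "largest mesh component =
bulk" series; sub-namespace `Literature.Probability.LatticeModels.TriMesh`; lattice coordinates,
`Ω' = triLinear ⁻¹' Ω`). A perfect triangle of column `k` all of whose corners are at distance
`< ε` from `Ω'ᶜ` (a *shallow* perfect triangle) lies inside the inner collar
`{z ∈ Ω' | infDist z Ω'ᶜ < ε + 2δ}`, and distinct triangles are disjoint. Hence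
(`exists_column_forall_not_shallowRun`): if the collar has area less than
`(#columns) · M · area B(0, δ/8)`, then some column `k` of any given finite set of columns contains
**no** run of `M` consecutive shallow perfect triangles. This is the counting step that provides a
"good column" for the parity argument of `TriMeshTriParity.lean` (port of `MeshGoodColumn.lean`,
the `δ/2`-balls about cell centres being replaced by the `δ/8`-balls about triangle centres).

Folklore. Mathlib anchors: `MeasureTheory.measureReal_biUnion_finset`,
`Measure.addHaar_real_ball`, `Metric.infDist`. H21 anchors: `TriMesh.ktri`, `TriMesh.IsPerfect`,
`TriMesh.IsCorner`, `TriMesh.ball_kcenter_subset_ktri`, `TriMesh.ktri_disjoint`,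
`TriMesh.infDist_lt_of_mem_ktri` (`TriMeshTriangles.lean`, `TriMeshTriCells.lean`).
-/

namespace Literature.Probability.LatticeModels.TriMesh

open Set Metric MeasureTheory

noncomputable section

variable {Ω : Set ℂ} {δ : ℝ}

/-- **Some column has no long shallow perfect run.** Let `Kset` be a finite set of columns and
`M : ℕ`. If the inner collar `{z ∈ Ω' | infDist z Ω'ᶜ < ε + 2δ}` of the sheared domain
`Ω' = triLinear ⁻¹' Ω` has area `< #Kset · M · area B(0, δ/8)`, then for some `k ∈ Kset` there is
no `j` such that the `M` triangles `j+1, …, j+M` of column `k` are all perfect with all corners at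
distance `< ε` from `Ω'ᶜ` (the `δ/8`-balls about the centres of such triangles would be disjoint
subsets of the collar). [folklore] -/
theorem exists_column_forall_not_shallowRun (hΩb : Bornology.IsBounded (triLinear ⁻¹' Ω)) (hδ : 0 < δ)
    {ε : ℝ} (Kset : Finset ℤ) (M : ℕ)
    (harea : volume.real {z ∈ triLinear ⁻¹' Ω | infDist z (triLinear ⁻¹' Ω)ᶜ < ε + 2 * δ} <
      Kset.card * M * ((δ / 8) ^ 2 * volume.real (ball (0 : ℂ) 1))) :
    ∃ k ∈ Kset, ∀ j : ℤ, ¬ ∀ m : ℕ, m < M →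
      IsPerfect Ω δ k (j + 1 + m) ∧
        ∀ v, IsCorner k (j + 1 + m) v → infDist (meshPoint δ v) (triLinear ⁻¹' Ω)ᶜ < ε := by
  by_contra hcon
  push Not at hcon
  -- choose a run in every column
  choose f hf using hcon
  set T : Set ℂ := {z ∈ triLinear ⁻¹' Ω | infDist z (triLinear ⁻¹' Ω)ᶜ < ε + 2 * δ} with hT
  set P : Finset (ℤ × ℕ) := Kset ×ˢ Finset.range M with hP
  -- the centre of the `m`-th triangle of the chosen run in column `k`
  let ctr : ℤ × ℕ → ℂ := fun p =>
    if h : p.1 ∈ Kset then kcenter δ p.1 (f p.1 h + 1 + p.2) else 0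
  have hctr : ∀ p ∈ P, ∃ h : p.1 ∈ Kset, ctr p = kcenter δ p.1 (f p.1 h + 1 + p.2) ∧ p.2 < M := by
    intro p hp
    rw [hP, Finset.mem_product, Finset.mem_range] at hp
    exact ⟨hp.1, by simp only [ctr, dif_pos hp.1], hp.2⟩
  -- the balls are pairwise disjoint
  have hdisj : (P : Set (ℤ × ℕ)).PairwiseDisjoint fun p => ball (ctr p) (δ / 8) := by
    rintro ⟨p1, p2⟩ hp ⟨q1, q2⟩ hq hpq
    obtain ⟨hp1, hpe, hpM⟩ := hctr _ hp
    obtain ⟨hq1, hqe, hqM⟩ := hctr _ hq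
    rw [Function.onFun, hpe, hqe]
    refine (ktri_disjoint hδ (k := p1) (n := f p1 hp1 + 1 + p2) (k' := q1)
      (n' := f q1 hq1 + 1 + q2) ?_).mono (ball_kcenter_subset_ktri hδ _ _)
      (ball_kcenter_subset_ktri hδ _ _)
    intro heq
    simp only [Prod.mk.injEq] at heq
    obtain ⟨h1, h2⟩ := heq
    apply hpq
    subst h1
    have : (p2 : ℤ) = q2 := by omega
    have : p2 = q2 := by exact_mod_cast this
    rw [this]
  -- and contained in the collar
  have hsub : (⋃ p ∈ P, ball (ctr p) (δ / 8)) ⊆ T := by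
    intro z hz
    simp only [mem_iUnion, exists_prop] at hz
    obtain ⟨p, hp, hz⟩ := hz
    obtain ⟨hp1, hpe, hpM⟩ := hctr p hp
    rw [hpe] at hz
    have hzc := ball_kcenter_subset_ktri hδ _ _ hz
    obtain ⟨hperf, hsh⟩ := hf p.1 hp1 p.2 hpM
    exact ⟨hperf.1 hzc, infDist_lt_of_mem_ktri (isCorner_xL _ _) (hsh _ (isCorner_xL _ _)) hzc⟩
  have hTfin : volume T ≠ ⊤ := (hΩb.subset fun z hz => hz.1).measure_lt_top.ne
  have hcard : (P.card : ℝ) = Kset.card * M := by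
    rw [hP, Finset.card_product, Finset.card_range]; push_cast; ring
  have key : (P.card : ℝ) * ((δ / 8) ^ 2 * volume.real (ball (0 : ℂ) 1)) ≤ volume.real T :=
    calc (P.card : ℝ) * ((δ / 8) ^ 2 * volume.real (ball (0 : ℂ) 1))
        = ∑ p ∈ P, volume.real (ball (ctr p) (δ / 8)) := by
          rw [← nsmul_eq_mul, ← Finset.sum_const]
          refine Finset.sum_congr rfl fun p _ => ?_
          rw [← Measure.addHaar_real_closedBall_eq_addHaar_real_ball volume (ctr p) (δ / 8),
            Measure.addHaar_real_closedBall volume _ (by positivity : (0 : ℝ) ≤ δ / 8),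
            Complex.finrank_real_complex]
      _ = volume.real (⋃ p ∈ P, ball (ctr p) (δ / 8)) :=
          (measureReal_biUnion_finset hdisj (fun _ _ => measurableSet_ball)
            (fun _ _ => measure_ball_lt_top.ne)).symm
      _ ≤ volume.real T := measureReal_mono hsub hTfin
  rw [hcard] at key
  linarith

end

end Literature.Probability.LatticeModels.TriMesh
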